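import Summits.Ventures.PercRepro.C026TwoHubGood

/-!
# The one-hub class of ROW C-041 `(G⅔)`: the skeleton `H = G⁺ + {h–a, h–b, a–b}` (p6, gen 22)

The hub family — `c` reaches the adjacent terminals `a, b` only through ONE hub `h` adjacent to
both — is the prototype equality case of `(G⅔)` (the hub `c–h–{a,b} + ab`: 3 sources, 1 GG, 2 Bad).
`G.attachOneHub a b h` is the hub graph `G` (with `a, b` edgeless) plus `0 = h–a`, `1 = h–b`,
`2 = a–b` (edge type `E ⊕ Fin 3`).  This file is the one-hub STEP 1: `DA_attachOne_iff` (a source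
⟺ the terminal edge is red, the hub is not `BB`, `c ~_red h` in `G⁺`, and `c ≁_blue h` in `G⁺` when
a hub edge is blue) and `goodA_attachOne_iff` / `goodB_attachOne_iff` (`Good_t` ⟺ the hub is `RR`),
with the same closed-boundary and first-entry arguments as the two-hub case (C026TwoHubSources /
C026TwoHubGood).  C026OneHubMain counts: `n(D,A) = N + 2P`, `#Good_a = #Good_b = N` with
`N = #{R}`, `P = #{R ∧ ¬B}`, so `(G⅔)` is `P ≤ N`, with equality iff a red `c`–`h` connection never
comes with a blue one (the hub family: `G⁺` a path).
-/

namespace PercRepro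

namespace MultiGraph

open Finset

variable {V E : Type*}

/-- **The one-hub attachment**: `G` (with `a`, `b` edgeless in it) plus `0 = h–a`, `1 = h–b`,
`2 = a–b`. -/
def attachOneHub (G : MultiGraph V E) (a b h : V) : MultiGraph V (E ⊕ Fin 3) where
  fst := Sum.elim G.fst ![h, h, a]
  snd := Sum.elim G.snd ![a, b, b]

variable {G : MultiGraph V E} {a b h c : V}

/-- First endpoint of a `G`-edge. -/
@[simp] theorem attachOneHub_fst_inl (e : E) : (G.attachOneHub a b h).fst (Sum.inl e) = G.fst e := rfl

/-- Second endpoint of a `G`-edge. -/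
@[simp] theorem attachOneHub_snd_inl (e : E) : (G.attachOneHub a b h).snd (Sum.inl e) = G.snd e := rfl

/-- First endpoints of the new edges. -/
@[simp] theorem attachOneHub_fst_inr (i : Fin 3) :
    (G.attachOneHub a b h).fst (Sum.inr i) = ![h, h, a] i := rfl

/-- Second endpoints of the new edges. -/
@[simp] theorem attachOneHub_snd_inr (i : Fin 3) :
    (G.attachOneHub a b h).snd (Sum.inr i) = ![a, b, b] i := rfl

/-- A `G`-step is a step of the attachment. -/
theorem openAdj_attachOne_of_openAdj {S : Config (E ⊕ Fin 3)} {x y : V}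
    (hxy : G.OpenAdj (S ∘ Sum.inl) x y) : (G.attachOneHub a b h).OpenAdj S x y := by
  obtain ⟨e, he, hend⟩ := hxy
  exact ⟨Sum.inl e, he, hend⟩

/-- A `G`-connection is a connection of the attachment. -/
theorem conn_attachOne_of_conn {S : Config (E ⊕ Fin 3)} {x y : V}
    (hxy : G.Conn (S ∘ Sum.inl) x y) : (G.attachOneHub a b h).Conn S x y := by
  unfold Conn at hxy ⊢
  induction hxy with
  | refl => exact Relation.ReflTransGen.refl
  | tail _ hst ih => exact ih.tail (openAdj_attachOne_of_openAdj hst)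

/-- A blue `G`-connection is a blue connection of the attachment. -/
theorem conn_attachOne_compl_of_conn {S : Config (E ⊕ Fin 3)} {x y : V}
    (hxy : G.Conn (S ∘ Sum.inl)ᶜ x y) : (G.attachOneHub a b h).Conn Sᶜ x y := by
  rw [← compl_comp_inl] at hxy
  exact conn_attachOne_of_conn hxy

/-- An edge of the attachment with no endpoint at a terminal is a `G`-edge. -/
theorem eq_inl_of_ne_terminals_one {f : E ⊕ Fin 3}
    (h1 : (G.attachOneHub a b h).fst f ≠ a) (h2 : (G.attachOneHub a b h).fst f ≠ b)
    (h3 : (G.attachOneHub a b h).snd f ≠ a) (h4 : (G.attachOneHub a b h).snd f ≠ b) :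
    ∃ e, f = Sum.inl e := by
  rcases f with e | i
  · exact ⟨e, rfl⟩
  · exfalso
    fin_cases i
    · exact h3 rfl
    · exact h4 rfl
    · exact h1 rfl

/-- A step of the attachment between two non-terminal vertices is a `G`-step. -/
theorem openAdj_of_openAdj_attachOne {S : Config (E ⊕ Fin 3)} {x y : V}
    (hxy : (G.attachOneHub a b h).OpenAdj S x y) (hxa : x ≠ a) (hxb : x ≠ b) (hya : y ≠ a)
    (hyb : y ≠ b) : G.OpenAdj (S ∘ Sum.inl) x y := by
  obtain ⟨f, hf, hend⟩ := hxy
  have hne : ∃ e, f = Sum.inl e := by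
    rcases hend with ⟨h1, h2⟩ | ⟨h1, h2⟩
    · exact eq_inl_of_ne_terminals_one (h1 ▸ hxa) (h1 ▸ hxb) (h2 ▸ hya) (h2 ▸ hyb)
    · exact eq_inl_of_ne_terminals_one (h1 ▸ hya) (h1 ▸ hyb) (h2 ▸ hxa) (h2 ▸ hxb)
  obtain ⟨e, rfl⟩ := hne
  exact ⟨e, hf, hend⟩

/-- Walks avoiding both terminals are the same in the attachment and in `G`. -/
theorem walkAvoiding_attachOne_iff {S : Config (E ⊕ Fin 3)} {W : Set V} (haW : a ∈ W) (hbW : b ∈ W)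
    {x y : V} :
    (G.attachOneHub a b h).WalkAvoiding S W x y ↔ G.WalkAvoiding (S ∘ Sum.inl) W x y := by
  constructor
  · rintro ⟨hx, hwalk⟩
    refine ⟨hx, ?_⟩
    induction hwalk using Relation.ReflTransGen.head_induction_on with
    | refl => exact Relation.ReflTransGen.refl
    | @head u u' huu' _ ih =>
      refine Relation.ReflTransGen.head ⟨?_, huu'.2⟩ (ih huu'.2)
      exact openAdj_of_openAdj_attachOne huu'.1 (fun h => hx (h ▸ haW)) (fun h => hx (h ▸ hbW))
        (fun h => huu'.2 (h ▸ haW)) (fun h => huu'.2 (h ▸ hbW))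
  · rintro ⟨hx, hwalk⟩
    exact ⟨hx, reflTransGen_of_imp (fun _ _ hxy => ⟨openAdj_attachOne_of_openAdj hxy.1, hxy.2⟩) hwalk⟩

/-- An open new edge joins its endpoints. -/
theorem openAdj_attachOne_inr {S : Config (E ⊕ Fin 3)} {i : Fin 3} (hi : S (Sum.inr i) = true) :
    (G.attachOneHub a b h).OpenAdj S (![h, h, a] i) (![a, b, b] i) :=
  (G.attachOneHub a b h).openAdj_of_open (Sum.inr i) hi

/-- A blue new edge joins its endpoints in the complement. -/
theorem openAdj_attachOne_compl_inr {S : Config (E ⊕ Fin 3)} {i : Fin 3}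
    (hi : S (Sum.inr i) = false) :
    (G.attachOneHub a b h).OpenAdj Sᶜ (![h, h, a] i) (![a, b, b] i) :=
  (G.attachOneHub a b h).openAdj_of_open (Sum.inr i) (by rw [compl_apply_not, hi]; rfl)

section Sources

variable (hab : a ≠ b) (hca : c ≠ a) (hcb : c ≠ b) (hha : h ≠ a) (hhb : h ≠ b)
  (hisoa : ∀ e, G.fst e ≠ a ∧ G.snd e ≠ a) (hisob : ∀ e, G.fst e ≠ b ∧ G.snd e ≠ b)

include hca hcb hisoa hisob in
/-- A red walk from `c` to a terminal enters the terminals through the hub, red-joined to `c` in `G`. -/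
theorem conn_hub_of_conn_attachOne {S : Config (E ⊕ Fin 3)} {t : V} (ht : t = a ∨ t = b)
    (hct : (G.attachOneHub a b h).Conn S c t) : G.Conn (S ∘ Sum.inl) c h := by
  have hc : c ∉ ({a, b} : Set V) := by
    simp only [Set.mem_insert_iff, Set.mem_singleton_iff, not_or]
    exact ⟨hca, hcb⟩
  have ht' : t ∈ ({a, b} : Set V) := by
    simp only [Set.mem_insert_iff, Set.mem_singleton_iff]
    exact ht
  obtain ⟨x, hx, w, hw, hwalk, hxw⟩ := exists_entry hct hc ht'
  have hcx : G.Conn (S ∘ Sum.inl) c x :=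
    ((walkAvoiding_attachOne_iff (by simp) (by simp)).1 ⟨hc, hwalk⟩).conn
  simp only [Set.mem_insert_iff, Set.mem_singleton_iff, not_or] at hx hw
  obtain ⟨f, _, hend⟩ := hxw
  rcases f with e | i
  · exfalso
    rcases hend with ⟨_, h2⟩ | ⟨h1, _⟩
    · rcases hw with rfl | rfl
      · exact (hisoa e).2 h2
      · exact (hisob e).2 h2
    · rcases hw with rfl | rfl
      · exact (hisoa e).1 h1
      · exact (hisob e).1 h1
  · fin_cases i
    · rcases hend with ⟨h1, _⟩ | ⟨_, h2⟩
      · exact (show x = h from h1.symm) ▸ hcx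
      · exact absurd (show x = a from h2.symm) hx.1
    · rcases hend with ⟨h1, _⟩ | ⟨_, h2⟩
      · exact (show x = h from h1.symm) ▸ hcx
      · exact absurd (show x = b from h2.symm) hx.2
    · rcases hend with ⟨h1, _⟩ | ⟨_, h2⟩
      · exact absurd (show x = a from h1.symm) hx.1
      · exact absurd (show x = b from h2.symm) hx.2

include hca hcb hisoa hisob in
/-- The blue cluster of the probe stays in the hub graph when the hub is blue-separated from `c`
there whenever a hub edge is blue, and the terminal edge is red. -/
theorem cluster_compl_c_subset_one {S : Config (E ⊕ Fin 3)} (h2 : S (Sum.inr 2) = true)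
    (hB0 : S (Sum.inr 0) = false → ¬ G.Conn (S ∘ Sum.inl)ᶜ c h)
    (hB1 : S (Sum.inr 1) = false → ¬ G.Conn (S ∘ Sum.inl)ᶜ c h) :
    (G.attachOneHub a b h).cluster Sᶜ c ⊆ G.cluster (S ∘ Sum.inl)ᶜ c := by
  intro v hv
  refine mem_of_conn_of_closed_boundary (X := G.cluster (S ∘ Sum.inl)ᶜ c) ?_
    (G.self_mem_cluster _ c) ((G.attachOneHub a b h).mem_cluster.1 hv)
  intro f hf
  rcases f with e | i
  · exact mem_cluster_iff_of_open (ω := (S ∘ Sum.inl)ᶜ) (G := G) (a := c)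
      (by rw [← compl_comp_inl]; exact hf)
  · have hna : a ∉ G.cluster (S ∘ Sum.inl)ᶜ c := not_mem_cluster_of_isolated hisoa hca
    have hnb : b ∉ G.cluster (S ∘ Sum.inl)ᶜ c := not_mem_cluster_of_isolated hisob hcb
    rw [compl_apply_not, Bool.not_eq_true'] at hf
    fin_cases i
    · simp only [attachOneHub_fst_inr, attachOneHub_snd_inr]
      exact iff_of_false (fun hmem => hB0 hf ((G.mem_cluster).1 hmem)) hna
    · simp only [attachOneHub_fst_inr, attachOneHub_snd_inr]
      exact iff_of_false (fun hmem => hB1 hf ((G.mem_cluster).1 hmem)) hnb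
    · exact absurd (hf.symm.trans h2) Bool.false_ne_true

include hab hha hhb hisoa hisob in
/-- The blue cluster of `a` is `a` together with the hub-graph blue cluster of the hub when the
`a`-edge is blue (the hub not `BB`, the terminal edge red). -/
theorem cluster_compl_a_subset_one {S : Config (E ⊕ Fin 3)} (h2 : S (Sum.inr 2) = true)
    (h01 : S (Sum.inr 0) = true ∨ S (Sum.inr 1) = true) :
    (G.attachOneHub a b h).cluster Sᶜ a ⊆
      {a} ∪ {v | S (Sum.inr 0) = false ∧ v ∈ G.cluster (S ∘ Sum.inl)ᶜ h} := by
  intro v hv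
  refine mem_of_conn_of_closed_boundary ?_ (by simp) ((G.attachOneHub a b h).mem_cluster.1 hv)
  intro f hf
  rcases f with e | i
  · simp only [attachOneHub_fst_inl, attachOneHub_snd_inl, Set.mem_union, Set.mem_singleton_iff,
      Set.mem_setOf_eq]
    have hf' : (S ∘ Sum.inl)ᶜ e = true := by rw [← compl_comp_inl]; exact hf
    have hh := mem_cluster_iff_of_open (ω := (S ∘ Sum.inl)ᶜ) (G := G) (a := h) hf'
    constructor
    · rintro (h1 | ⟨h0, hm⟩)
      · exact absurd h1 (hisoa e).1
      · exact Or.inr ⟨h0, hh.1 hm⟩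
    · rintro (h1 | ⟨h0, hm⟩)
      · exact absurd h1 (hisoa e).2
      · exact Or.inr ⟨h0, hh.2 hm⟩
  · rw [compl_apply_not, Bool.not_eq_true'] at hf
    fin_cases i
    · simp only [attachOneHub_fst_inr, attachOneHub_snd_inr, Set.mem_union, Set.mem_singleton_iff,
        Set.mem_setOf_eq]
      exact iff_of_true (Or.inr ⟨hf, G.self_mem_cluster _ h⟩) (Or.inl rfl)
    · simp only [attachOneHub_fst_inr, attachOneHub_snd_inr, Set.mem_union, Set.mem_singleton_iff,
        Set.mem_setOf_eq]
      refine iff_of_false ?_ ?_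
      · rintro (h1 | ⟨h0, _⟩)
        · exact hha h1
        · simp only [h0, Bool.false_eq_true, false_or] at h01
          exact Bool.false_ne_true (hf.symm.trans h01)
      · rintro (h1 | ⟨_, hm⟩)
        · exact hab h1.symm
        · exact not_mem_cluster_of_isolated hisob hhb hm
    · exact absurd (hf.symm.trans h2) Bool.false_ne_true

include hab hha hhb hisoa hisob in
/-- The mirror for `b`. -/
theorem cluster_compl_b_subset_one {S : Config (E ⊕ Fin 3)} (h2 : S (Sum.inr 2) = true)
    (h01 : S (Sum.inr 0) = true ∨ S (Sum.inr 1) = true) :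
    (G.attachOneHub a b h).cluster Sᶜ b ⊆
      {b} ∪ {v | S (Sum.inr 1) = false ∧ v ∈ G.cluster (S ∘ Sum.inl)ᶜ h} := by
  intro v hv
  refine mem_of_conn_of_closed_boundary ?_ (by simp) ((G.attachOneHub a b h).mem_cluster.1 hv)
  intro f hf
  rcases f with e | i
  · simp only [attachOneHub_fst_inl, attachOneHub_snd_inl, Set.mem_union, Set.mem_singleton_iff,
      Set.mem_setOf_eq]
    have hf' : (S ∘ Sum.inl)ᶜ e = true := by rw [← compl_comp_inl]; exact hf
    have hh := mem_cluster_iff_of_open (ω := (S ∘ Sum.inl)ᶜ) (G := G) (a := h) hf'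
    constructor
    · rintro (h1 | ⟨h0, hm⟩)
      · exact absurd h1 (hisob e).1
      · exact Or.inr ⟨h0, hh.1 hm⟩
    · rintro (h1 | ⟨h0, hm⟩)
      · exact absurd h1 (hisob e).2
      · exact Or.inr ⟨h0, hh.2 hm⟩
  · rw [compl_apply_not, Bool.not_eq_true'] at hf
    fin_cases i
    · simp only [attachOneHub_fst_inr, attachOneHub_snd_inr, Set.mem_union, Set.mem_singleton_iff,
        Set.mem_setOf_eq]
      refine iff_of_false ?_ ?_
      · rintro (h1 | ⟨h1, _⟩)
        · exact hhb h1
        · simp only [h1, Bool.false_eq_true, or_false] at h01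
          exact Bool.false_ne_true (hf.symm.trans h01)
      · rintro (h1 | ⟨_, hm⟩)
        · exact hab h1
        · exact not_mem_cluster_of_isolated hisoa hha hm
    · simp only [attachOneHub_fst_inr, attachOneHub_snd_inr, Set.mem_union, Set.mem_singleton_iff,
        Set.mem_setOf_eq]
      exact iff_of_true (Or.inr ⟨hf, G.self_mem_cluster _ h⟩) (Or.inl rfl)
    · exact absurd (hf.symm.trans h2) Bool.false_ne_true

include hab hca hcb hha hhb hisoa hisob in
/-- **The one-hub sources**: `S` is a `(D,A)` source of `G.attachOneHub a b h` iff the terminal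
edge is red, the hub is not `BB`, `c ~_red h` in the hub graph, and `c ≁_blue h` there whenever a
hub edge is blue. -/
theorem DA_attachOne_iff (S : Config (E ⊕ Fin 3)) :
    (((G.attachOneHub a b h).Conn S c a ∧ (G.attachOneHub a b h).Conn S c b) ∧
      (¬ (G.attachOneHub a b h).Conn Sᶜ c a ∧ ¬ (G.attachOneHub a b h).Conn Sᶜ c b ∧
        ¬ (G.attachOneHub a b h).Conn Sᶜ a b)) ↔
    (S (Sum.inr 2) = true ∧ (S (Sum.inr 0) = true ∨ S (Sum.inr 1) = true) ∧
      G.Conn (S ∘ Sum.inl) c h ∧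
      (S (Sum.inr 0) = false → ¬ G.Conn (S ∘ Sum.inl)ᶜ c h) ∧
      (S (Sum.inr 1) = false → ¬ G.Conn (S ∘ Sum.inl)ᶜ c h)) := by
  constructor
  · rintro ⟨⟨hca', _⟩, hAca, hAcb, hAab⟩
    have e0 : S (Sum.inr 0) = false → (G.attachOneHub a b h).Conn Sᶜ h a := fun hf =>
      Conn.of_openAdj (openAdj_attachOne_compl_inr hf)
    have e1 : S (Sum.inr 1) = false → (G.attachOneHub a b h).Conn Sᶜ h b := fun hf =>
      Conn.of_openAdj (openAdj_attachOne_compl_inr hf)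
    refine ⟨?_, ?_, conn_hub_of_conn_attachOne hca hcb hisoa hisob (Or.inl rfl) hca', ?_, ?_⟩
    · by_contra hf
      rw [Bool.not_eq_true] at hf
      exact hAab (Conn.of_openAdj (openAdj_attachOne_compl_inr hf))
    · by_contra hf
      simp only [Bool.not_eq_true, not_or] at hf
      exact hAab ((e0 hf.1).symm.trans (e1 hf.2))
    · exact fun hf hB => hAca ((conn_attachOne_compl_of_conn hB).trans (e0 hf))
    · exact fun hf hB => hAcb ((conn_attachOne_compl_of_conn hB).trans (e1 hf))
  · rintro ⟨h2, h01, hR, hB0, hB1⟩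
    have hab' : (G.attachOneHub a b h).Conn S a b := Conn.of_openAdj (openAdj_attachOne_inr h2)
    have hha' : (G.attachOneHub a b h).Conn S h a ∧ (G.attachOneHub a b h).Conn S h b := by
      rcases h01 with h0 | h1
      · have := Conn.of_openAdj (openAdj_attachOne_inr (G := G) (a := a) (b := b) (h := h) h0)
        exact ⟨this, this.trans hab'⟩
      · have := Conn.of_openAdj (openAdj_attachOne_inr (G := G) (a := a) (b := b) (h := h) h1)
        exact ⟨this.trans hab'.symm, this⟩
    refine ⟨⟨(conn_attachOne_of_conn hR).trans hha'.1, (conn_attachOne_of_conn hR).trans hha'.2⟩,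
      ?_, ?_, ?_⟩
    · intro hc
      exact not_mem_cluster_of_isolated hisoa hca
        (cluster_compl_c_subset_one hca hcb hisoa hisob h2 hB0 hB1
          ((G.attachOneHub a b h).mem_cluster.2 hc))
    · intro hc
      exact not_mem_cluster_of_isolated hisob hcb
        (cluster_compl_c_subset_one hca hcb hisoa hisob h2 hB0 hB1
          ((G.attachOneHub a b h).mem_cluster.2 hc))
    · intro hc
      have hmem := cluster_compl_a_subset_one hab hha hhb hisoa hisob h2 h01
        ((G.attachOneHub a b h).mem_cluster.2 hc)
      simp only [Set.mem_union, Set.mem_singleton_iff, Set.mem_setOf_eq] at hmem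
      rcases hmem with h1 | ⟨_, hm⟩
      · exact hab h1.symm
      · exact not_mem_cluster_of_isolated hisob hhb hm

end Sources

end MultiGraph

end PercRepro
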